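import Literature.NumberTheory.LFunctions.FordProgram1Run23A
import Literature.NumberTheory.LFunctions.FordProgram1Run23B
import Literature.NumberTheory.LFunctions.FordProgram1Run23C
import HarnessLib

/-!
# Ford's "Program 1": kernel run 23 (`866 ≤ k ≤ 884`)

Topic `Literature/NumberTheory/LFunctions`. Everything here is PROVED (standard axioms):
`FordP1.checkT k = true` for `866 ≤ k ≤ 884`, i.e. the certified re-run of PROGRAM 1 of
K. Ford, Proc. LMS 85 (2002) (the second part of Theorem 3) for these `k` — see `FordProgram1.lean`
for the checker, its soundness `FordP1.row_of_checkK`, and the meaning of the constants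
(`ρ = FordP1.rhoOf k / 10⁵`, `θ = FordP1.thetaOf k / 10⁴`, `ω = FordP1.omOf k / 10⁴`).

This file originally did the whole range in ONE kernel evaluation
(`decide +kernel` on `(List.range' 866 19).all checkT`), which no longer completes within the
resources of the full build. The kernel work now lives in the split files
`FordProgram1Run23A.lean` (`866 ≤ k ≤ 872`), `FordProgram1Run23B.lean` (`873 ≤ k ≤ 879`) and
`FordProgram1Run23C.lean` (`880 ≤ k ≤ 884`) — one `decide +kernel` per `k` — and the range
statement `FordP1.run23` below (same statement as before) is assembled from `FordP1.run23A/B/C`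
by an elementary case split, with no kernel evaluation in this file. The assembly of all runs is
`FordTheorem3SmallK.lean` (which imports the split files directly).

## References

* K. Ford, Proc. London Math. Soc. (3) 85 (2002), 565–633; arXiv:1910.08209: Theorem 3, (1.7),
  Lemmas 3.4–3.5, Appendix "PROGRAM 1". [Ford2002]
-/

namespace Literature.NumberTheory.LFunctions
namespace FordP1

/-- **Kernel run 23**: `checkT k` for `866 ≤ k ≤ 884` (assembled from the split kernel runs
`run23A`, `run23B`, `run23C`). [cite: Ford2002, Theorem 3 (second part) and PROGRAM 1] -/
theorem run23 : ((List.range' 866 19).all checkT) = true := by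
  rw [List.all_eq_true]
  intro k hk
  obtain ⟨h1, h2⟩ := List.mem_range'_1.mp hk
  rcases lt_or_ge k 873 with h | h
  · exact run23A k h1 (by omega)
  rcases lt_or_ge k 880 with h' | h'
  · exact run23B k h (by omega)
  · exact run23C k h' (by omega)

end FordP1
end Literature.NumberTheory.LFunctions
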